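import Mathlib
import Summits.Ventures.HodgeRepro.Tier4.Common.LocalCoordinates
import Summits.Ventures.HodgeRepro.Tier4.Common.RowWeights

/-!
# Tier4/Line4/D3Coeff — C-L4-D3COEFF: the weight-3 discrete-series coefficient at a real place, as a NAMED function on
`U(W)(𝔸)` in typer-2's local coordinates, and its kernel properties (continuity, the bound, the `T_w`-weight `(−3, 0)` on
both sides, conjugation)

Blind re-derivation cell `pub-hodge-repro`, Tier 4 (README §9–§10), seat t4-L1-p5 (prover, gen 4; cut C-L4-D3COEFF,
lead (R-8) S14747; kernel shape S14811 (1); paper proofs/t4/L4/D3COEFF-t4-L1-p5.md §1–§2).  Target tree path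
`lean/Summits/Ventures/HodgeRepro/Tier4/Line4/D3Coeff.lean`.  On typer-2 g4's `Common/LocalCoordinates` (p698758:
`locEntry`, `locMat`, `locMat_mul`, `locMat_one`, `continuous_locEntry`, `locEntry_diag_eq_weightAt`) and
the row planes `ofLinesRow q a b ε` (the seesaw plane of LINE L4 is `mixedRow q a₀ a₂ = ofLinesRow q a₀ a₂ (−1)` with a
transported second torus); no printed input.

THE OBJECT.  At a real CM place `w` the `w`-block of `g ∈ U(W)(𝔸)` is the `2 × 2` complex matrix `locMat g` with
`(0,0)`-entry `α(g) = locEntry q a b ε w g 0 0`; under the signature hypotheses of the seesaw plane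
(`0 < a_w`, `(εb)_w < 0`) the block is in `U(1,1)` and `|α| ≥ 1` (LocalUnitary).  The lowest-weight matrix
coefficient of the weight-3 holomorphic discrete series `D₃` of `SU(1,1)` in the Bergman model is `⟨D₃(g) 1, 1⟩ = ᾱ^{−3}`
(Varadarajan 1989 §6.5, `f(a_t) = const · (cosh t)^{−3}`; lit-5 rows 65–66, typed as `Lit.varadarajanCoeff 3` on
`SL(2, ℝ)`, p698221); here **`D3coeff q a b ε w g := α(g)⁻¹ ^ 3`**.

WHAT IS PROVED (kernel; no print).
* `D3coeff_one`.
* THE TORUS IS DIAGONAL IN THE LOCAL COORDINATES: `locEntry_off_diag_of_mem_torusT` (RowWeights' block description of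
  a torus element, read through `blocksOf_re4R_fromBlocks`), hence `locEntry_mul_zero_zero_of_mem_torusT` /
  `locEntry_zero_zero_mul_of_mem_torusT` — `α(g κ) = α(g) · u₁(κ)`, `α(κ g) = u₁(κ) · α(g)` for `κ ∈ T(𝔸)`, with
  `u₁(κ) = weightAt … 0 κ` the weight on the first line (`locEntry_diag_eq_weightAt`).
* **THE EQUIVARIANCE LAWS** `D3coeff_mul_torus` / `D3coeff_torus_mul`: `D3coeff (g κ) = u₁(κ)⁻¹ ^ 3 · D3coeff g` and
  `D3coeff (κ g) = u₁(κ)⁻¹ ^ 3 · D3coeff g` — the coefficient has `T_w`-weight `(−3, 0)` on both sides (the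
  `_he = ±3` of L4-MATH §15.1 made explicit; these are the `hfin` inputs of ArchFactorMismatch p698589).
The LocalUnitary-dependent facts — continuity and the bound `‖D3coeff‖ ≤ 1` (`α ≠ 0`, `|α| ≥ 1` on `U(1,1)`),
`D3coeff g⁻¹ = conj (D3coeff g)` — are the companion module `Tier4/Line4/D3CoeffUnitary.lean`.

NOT here (displayed in the line, per S14811 (3)): integrability on `G_∞` (Harish-Chandra, `k ≥ 3`), the operator Schur
vanishing (`IsPseudoCoeffAt(')`), and the sufficient direction of the archimedean factor.  Nothing here says anything
about the status of the Hodge conjecture for CM abelian varieties, which is NOT proved (HC_CM is NOT proved by anyone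
in this repository).
-/

set_option autoImplicit false

noncomputable section

namespace Summit.Ventures.HodgeRepro.Tier4.Line4

open Summit.Ventures.HodgeRepro.Tier4.Common NumberField Matrix

section D3

variable {k : Type} [Field k] [NumberField k] (q : QuadData k) (a b ε : k) (w : InfinitePlace k)

/-- **the weight-3 discrete-series coefficient at `w`**: `α(g)⁻¹ ^ 3`, `α(g) = locEntry q a b ε w g 0 0` the `(0,0)`
entry of the `w`-block of `g` in the complex coordinates (the lowest-weight coefficient `ᾱ^{−3}` of `D₃`; the junk
value `0⁻¹ = 0` never occurs on `U(1,1)`, `locEntry_zero_zero_ne_zero`). -/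
def D3coeff (g : GA (PlaneData.ofLinesRow q a b ε)) : ℂ := (locEntry q a b ε w g 0 0)⁻¹ ^ 3

/-- `D3coeff 1 = 1`. -/
theorem D3coeff_one : D3coeff q a b ε w 1 = 1 := by
  have h : locEntry q a b ε w 1 0 0 = 1 := by
    rw [← locMat_apply, locMat_one]
    simp
  simp [D3coeff, h]

/-- **the torus is diagonal in the local coordinates**: the off-diagonal coordinates of a torus element vanish
(RowWeights' block description `blockDiag4R (blockOf …) (blockOf …)`, whose off-diagonal blocks are `0`). -/
theorem locEntry_off_diag_of_mem_torusT (ha : a ≠ 0) (hb : b ≠ 0) (hε : ε ≠ 0)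
    (κ : GA (PlaneData.ofLinesRow q a b ε)) (hκ : κ ∈ torusT (PlaneData.ofLinesRow q a b ε)) :
    locEntry q a b ε w κ 0 1 = 0 ∧ locEntry q a b ε w κ 1 0 = 0 := by
  obtain ⟨x₀, y₀, x₁, y₁, hmat, -, -⟩ := exists_blockOf_of_mem_torusT q a b ε ha hb hε κ hκ
  have h01 : blocksOf (GA.mat (PlaneData.ofLinesRow q a b ε) κ) 0 1 = 0 := by
    rw [hmat]
    exact (blocksOf_re4R_fromBlocks _ _ _ _).2.1
  have h10 : blocksOf (GA.mat (PlaneData.ofLinesRow q a b ε) κ) 1 0 = 0 := by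
    rw [hmat]
    exact (blocksOf_re4R_fromBlocks _ _ _ _).2.2.1
  constructor
  · rw [locEntry_eq_blockWeight, h01]
    simp [blockWeight]
  · rw [locEntry_eq_blockWeight, h10]
    simp [blockWeight]

/-- **`α(g κ) = α(g) · u₁(κ)`** for a torus element `κ`, `u₁(κ) = weightAt … 0 κ` (the `(0,0)` entry of the product of
the blocks, the torus block being diagonal). -/
theorem locEntry_mul_zero_zero_of_mem_torusT (hw : w.IsReal) (hcm : IsCMAt q w) (ha : a ≠ 0) (hb : b ≠ 0)
    (hε : ε ≠ 0) (g κ : GA (PlaneData.ofLinesRow q a b ε)) (hκ : κ ∈ torusT (PlaneData.ofLinesRow q a b ε)) :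
    locEntry q a b ε w (g * κ) 0 0 =
      locEntry q a b ε w g 0 0 * weightAt (PlaneData.ofLinesRow q a b ε) q w 0 κ := by
  have hmul := congrFun (congrFun (locMat_mul q a b ε w hw hcm g κ) 0) 0
  rw [locMat_apply, Matrix.mul_apply, Fin.sum_univ_two, locMat_apply, locMat_apply, locMat_apply, locMat_apply,
    (locEntry_off_diag_of_mem_torusT q a b ε w ha hb hε κ hκ).2, mul_zero, add_zero] at hmul
  exact hmul

/-- **`α(κ g) = u₁(κ) · α(g)`** for a torus element `κ`. -/
theorem locEntry_zero_zero_mul_of_mem_torusT (hw : w.IsReal) (hcm : IsCMAt q w) (ha : a ≠ 0) (hb : b ≠ 0)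
    (hε : ε ≠ 0) (g κ : GA (PlaneData.ofLinesRow q a b ε)) (hκ : κ ∈ torusT (PlaneData.ofLinesRow q a b ε)) :
    locEntry q a b ε w (κ * g) 0 0 =
      weightAt (PlaneData.ofLinesRow q a b ε) q w 0 κ * locEntry q a b ε w g 0 0 := by
  have hmul := congrFun (congrFun (locMat_mul q a b ε w hw hcm κ g) 0) 0
  rw [locMat_apply, Matrix.mul_apply, Fin.sum_univ_two, locMat_apply, locMat_apply, locMat_apply, locMat_apply,
    (locEntry_off_diag_of_mem_torusT q a b ε w ha hb hε κ hκ).1, zero_mul, add_zero] at hmul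
  exact hmul

/-- **THE EQUIVARIANCE LAW (right)**: `D3coeff (g κ) = u₁(κ)⁻¹ ^ 3 · D3coeff g` for `κ ∈ T(𝔸)` — the coefficient has
`T_w`-weight `(−3, 0)` under right translation. -/
theorem D3coeff_mul_torus (hw : w.IsReal) (hcm : IsCMAt q w) (ha : a ≠ 0) (hb : b ≠ 0) (hε : ε ≠ 0)
    (g κ : GA (PlaneData.ofLinesRow q a b ε)) (hκ : κ ∈ torusT (PlaneData.ofLinesRow q a b ε)) :
    D3coeff q a b ε w (g * κ) =
      (weightAt (PlaneData.ofLinesRow q a b ε) q w 0 κ)⁻¹ ^ 3 * D3coeff q a b ε w g := by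
  unfold D3coeff
  rw [locEntry_mul_zero_zero_of_mem_torusT q a b ε w hw hcm ha hb hε g κ hκ, mul_inv, mul_pow, mul_comm]

/-- **THE EQUIVARIANCE LAW (left)**: `D3coeff (κ g) = u₁(κ)⁻¹ ^ 3 · D3coeff g` for `κ ∈ T(𝔸)`. -/
theorem D3coeff_torus_mul (hw : w.IsReal) (hcm : IsCMAt q w) (ha : a ≠ 0) (hb : b ≠ 0) (hε : ε ≠ 0)
    (g κ : GA (PlaneData.ofLinesRow q a b ε)) (hκ : κ ∈ torusT (PlaneData.ofLinesRow q a b ε)) :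
    D3coeff q a b ε w (κ * g) =
      (weightAt (PlaneData.ofLinesRow q a b ε) q w 0 κ)⁻¹ ^ 3 * D3coeff q a b ε w g := by
  unfold D3coeff
  rw [locEntry_zero_zero_mul_of_mem_torusT q a b ε w hw hcm ha hb hε g κ hκ, mul_inv, mul_pow]

end D3

end Summit.Ventures.HodgeRepro.Tier4.Line4

end
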